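import Literature.NumberTheory.EllipticCurves.SupersingularTorsionDegreeBoundProofs
import Literature.NumberTheory.EllipticCurves.TorsionCardinality
import Literature.NumberTheory.EllipticCurves.FormalGroupLaurentPointsAllCharProofs
import Mathlib.NumberTheory.Padics.RingHoms
import HarnessLib

/-!
# Route `ThetaPartnerAtTwo` (TP2), crux K3 `SignedKatoDivisibilityUpToAtTwo` (item stmt-BirchSwinnertonDyer-20308),
# line `colemanrat` v3 — THE LOCAL THEORY AT `p = 2`, file 4: Kobayashi's Prop. 8.7 AT `p = 2` —
# no `2`-torsion over any `k/ℚ₂` of degree prime to `3` for a good supersingular curve at `2`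

HONEST FRAMING (cell `bsd-wall`, lead `bsd-wall-tp2-p2x` g2): THEOREMS ONLY — no definition, no named fact, no
instance, no `sorry`; a local statement about `2`-torsion; nothing about any Selmer group is asserted; closes no
item; BSD is NOT proved by any of this.

## Why this file

The generation / trace theorems of Kobayashi's local `±` theory (tree: `KobayashiTowerGeneration`; all-primes port
`…SignedKatoUpToAtTwoLocalTowerGeneration`) carry the hypothesis `htors` «no `p`-power torsion in `E(ℚ_p(ζ_{p^m}))`»
(Kobayashi Prop. 8.7). For ODD `p` the tree discharges it by Serre's degree bound `deg_{ℚ_p} x(P) ≥ (p² − 1)/2` for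
`P ∈ E[p] ∖ 0` (`SupersingularTorsionDegreeBoundProofs`, via `ψ_p`, `p` odd) — useless at `p = 2`
(`(p² − 1)/2 = 3/2`). At `p = 2` the right statement is a DIVISIBILITY: the `2`-division polynomial of a good
supersingular model `M/ℤ₂` (`2 ∣ a₁`, whence `a₃ ∈ ℤ₂ˣ` since the reduction is elliptic) is
`Ψ₂Sq = 4x³ + b₂x² + 2b₄x + b₆` with `b₂, 2b₄ ∈ 4ℤ₂` and `b₆ = a₃² + 4a₆ ∈ ℤ₂ˣ`, so by two-term domination every
root has `|x| > 1` and `|4|·|x|³ = 1`, i.e. `|x| = 2^{2/3}`: the degree of `x(P)` over `ℚ₂` is divisible by `3` for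
every `P ∈ E(ℚ̄₂)[2] ∖ O` (the formal group has height `2`: slope `1/3`). Hence `E(k)[2^∞] = 0` for every `k/ℚ₂`
with `3 ∤ [k : ℚ₂]` — in particular along the whole `2`-adic cyclotomic tower `ℚ₂(ζ_{2^m})` (degrees `2^{m−1}`)
and the `ℤ₂`-layers `ℚ₂(ζ_{2^{n+2}})⁺` (degrees `2ⁿ`): Prop. 8.7 at `p = 2`, the `htors` input of the `2`-adic port.

## What is proved (`M/ℤ₂` with elliptic special fibre and `a₁(M) ∈ 2ℤ₂`)

* §1 `isUnit_a₃_of_a₁_mem`, `isUnit_b₆_of_a₁_mem`, `exists_b₂_eq_four_mul`, `exists_two_mul_b₄_eq_four_mul`.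
* §2 `one_lt_valuation_X_of_two_smul_eq_zero`: for an affine point `P = (x, y)` of `M ⊗ ℚ̄₂` with `2 • P = O`,
  `|x| > 1` and `|4|·|x|³ = 1` (spectral absolute value of `ℚ̄₂`).
* §3 `three_dvd_natDegree_minpoly_X_of_two_smul_eq_zero` (`3 ∣ deg_{ℚ₂} x(P)`);
  `two_smul_some_ne_zero_of_forall_apply_eq` / `eq_zero_of_two_smul_eq_zero_of_forall_map_eq` (a point fixed by a
  subgroup `H ≤ Gal(ℚ̄₂/ℚ₂)` of finite index NOT divisible by `3` and killed by `2` is `O`);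
  `eq_zero_of_two_pow_smul_eq_zero_of_forall_map_eq` (same for `2^k`).

References: [Kobayashi2003] Prop. 8.7 (p. 16); [SerreInventiones1972] §1.11 Prop. 12; [SilvermanAEC2009] III.1,
III.2.3, Exercise 3.7, VII.3; [KuriharaOtsuki2006] Prop. 1.1 (proof: `a₁` even, `a₃` odd at supersingular `2`).
-/

set_option autoImplicit false
-- the Theorems namespace of this sub repeats the summit name by design (D-0017 nested layout)
set_option linter.dupNamespace false

noncomputable section

open scoped Classical NNReal
open Polynomial

namespace Summit.BirchSwinnertonDyer.BirchSwinnertonDyer.Theorems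

namespace SignedKatoOffTwo.LocalTwo

open WeierstrassCurve Literature.NumberTheory.EllipticCurves

/-! ## §1 The good supersingular model at `2`: `a₃, b₆ ∈ ℤ₂ˣ`, `b₂, 2b₄ ∈ 4ℤ₂` -/

section Model

variable (M : WeierstrassCurve ℤ_[2])

/-- For a `ℤ₂`-model with elliptic reduction and `2 ∣ a₁`: `a₃ ∈ ℤ₂ˣ` (in characteristic `2`, `a₁ = a₃ = 0` forces
`Δ = 0`; Kurihara–Otsuki Prop. 1.1, proof). [cite: KuriharaOtsuki2006, Prop. 1.1 (p. 560)] [cite: SilvermanAEC2009, App. A Prop. 1.1] -/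
theorem isUnit_a₃_of_a₁_mem [hEt : (M.map PadicInt.toZMod).IsElliptic]
    (h₁ : M.a₁ ∈ IsLocalRing.maximalIdeal ℤ_[2]) : IsUnit M.a₃ := by
  have hker : ∀ c : ℤ_[2], c ∈ IsLocalRing.maximalIdeal ℤ_[2] ↔ PadicInt.toZMod c = 0 := fun c => by
    rw [← PadicInt.ker_toZMod, RingHom.mem_ker]
  have ha₁ : (M.map (PadicInt.toZMod (p := 2))).a₁ = 0 := by rw [map_a₁]; exact (hker _).mp h₁
  rcases (M.map (PadicInt.toZMod (p := 2))).a₁_ne_zero_or_a₃_ne_zero_of_two (by decide) with h | h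
  · exact absurd ha₁ h
  · rw [map_a₃] at h
    by_contra hu
    exact h ((hker _).mp ((IsLocalRing.mem_maximalIdeal _).mpr hu))

/-- `b₂ = a₁² + 4a₂ ∈ 4ℤ₂` when `2 ∣ a₁`. [cite: SilvermanAEC2009, III.1] -/
theorem exists_b₂_eq_four_mul (h₁ : M.a₁ ∈ IsLocalRing.maximalIdeal ℤ_[2]) : ∃ c : ℤ_[2], M.b₂ = 4 * c := by
  rw [PadicInt.maximalIdeal_eq_span_p, Ideal.mem_span_singleton] at h₁
  obtain ⟨t, ht⟩ := h₁
  refine ⟨t ^ 2 + M.a₂, ?_⟩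
  rw [WeierstrassCurve.b₂, ht]; push_cast; ring

/-- `2b₄ = 4a₄ + 2a₁a₃ ∈ 4ℤ₂` when `2 ∣ a₁`. [cite: SilvermanAEC2009, III.1] -/
theorem exists_two_mul_b₄_eq_four_mul (h₁ : M.a₁ ∈ IsLocalRing.maximalIdeal ℤ_[2]) :
    ∃ c : ℤ_[2], 2 * M.b₄ = 4 * c := by
  rw [PadicInt.maximalIdeal_eq_span_p, Ideal.mem_span_singleton] at h₁
  obtain ⟨t, ht⟩ := h₁
  refine ⟨M.a₄ + t * M.a₃, ?_⟩
  rw [WeierstrassCurve.b₄, ht]; push_cast; ring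

/-- `b₆ = a₃² + 4a₆ ∈ ℤ₂ˣ` when `2 ∣ a₁` (`a₃ ∈ ℤ₂ˣ`). [cite: SilvermanAEC2009, III.1] -/
theorem isUnit_b₆_of_a₁_mem [hEt : (M.map PadicInt.toZMod).IsElliptic]
    (h₁ : M.a₁ ∈ IsLocalRing.maximalIdeal ℤ_[2]) : IsUnit M.b₆ := by
  have h3 := isUnit_a₃_of_a₁_mem M h₁
  by_contra hu
  have hmem : M.b₆ ∈ IsLocalRing.maximalIdeal ℤ_[2] := (IsLocalRing.mem_maximalIdeal _).mpr hu
  have h4 : (4 : ℤ_[2]) * M.a₆ ∈ IsLocalRing.maximalIdeal ℤ_[2] := by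
    rw [PadicInt.maximalIdeal_eq_span_p, Ideal.mem_span_singleton]
    exact ⟨2 * M.a₆, by push_cast; ring⟩
  have hsq : M.a₃ ^ 2 ∈ IsLocalRing.maximalIdeal ℤ_[2] := by
    have e : M.a₃ ^ 2 = M.b₆ - 4 * M.a₆ := by rw [WeierstrassCurve.b₆]; ring
    rw [e]; exact Ideal.sub_mem _ hmem h4
  have ha₃ : M.a₃ ∈ IsLocalRing.maximalIdeal ℤ_[2] := Ideal.IsPrime.mem_of_pow_mem inferInstance 2 hsq
  exact (IsLocalRing.mem_maximalIdeal _).mp ha₃ h3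

end Model

/-! ## §2 The absolute value of the `2`-torsion -/

section Valuation

variable (M : WeierstrassCurve ℤ_[2]) [hEt : (M.map PadicInt.toZMod).IsElliptic]

/-- `‖4‖₂ = 1/4`. [folklore] -/
theorem padicNorm_four : ‖(4 : ℚ_[2])‖ = 4⁻¹ := by
  rw [show (4 : ℚ_[2]) = (2 : ℚ_[2]) ^ 2 by norm_num, norm_pow,
    show (2 : ℚ_[2]) = ((2 : ℕ) : ℚ_[2]) by norm_num, Padic.norm_p]
  norm_num

/-- **`|x(P)| > 1` and `|4|·|x(P)|³ = 1` for every affine `2`-torsion point `P = (x, y)` of `M ⊗ ℚ̄₂`**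
(`M/ℤ₂` with elliptic reduction and `2 ∣ a₁`): `x` is a root of `Ψ₂Sq = 4x³ + b₂x² + 2b₄x + b₆` with `|b₆| = 1`,
`|4| < 1`, `|b₂|, |2b₄| ≤ |4|`, and two-term domination (`one_lt_valuation_and_mul_pow_eq_one_of_eval_eq_zero`).
The `p = 2` twin of Serre's `|p|·|x|^{(p²−1)/2} = 1`. [cite: SerreInventiones1972, §1.11 Prop. 12]
[cite: SilvermanAEC2009, Exercise 3.7] -/
theorem one_lt_valuation_X_of_two_smul_eq_zero {w : Valuation (AlgebraicClosure ℚ_[2]) ℝ≥0}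
    (hw : ∀ x, (w x : ℝ) = spectralNorm ℚ_[2] (AlgebraicClosure ℚ_[2]) x)
    (h₁ : M.a₁ ∈ IsLocalRing.maximalIdeal ℤ_[2])
    {x y : AlgebraicClosure ℚ_[2]} {h : (M.baseChange (AlgebraicClosure ℚ_[2])).toAffine.Nonsingular x y}
    (hP : (2 : ℤ) • (WeierstrassCurve.Affine.Point.some x y h :
      (M.baseChange (AlgebraicClosure ℚ_[2])).toAffine.Point) = 0) :
    1 < w x ∧ w (4 : AlgebraicClosure ℚ_[2]) * w x ^ 3 = 1 := by
  -- the valuation of the integers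
  have hR : ∀ c : ℤ_[2], w (algebraMap ℤ_[2] (AlgebraicClosure ℚ_[2]) c) ≤ 1 := by
    intro c
    rw [IsScalarTower.algebraMap_apply ℤ_[2] ℚ_[2] (AlgebraicClosure ℚ_[2]), ← NNReal.coe_le_coe,
      padicSpectralValuation_algebraMap hw, NNReal.coe_one]
    exact PadicInt.norm_le_one c
  have hRu : ∀ c : ℤ_[2], IsUnit c → w (algebraMap ℤ_[2] (AlgebraicClosure ℚ_[2]) c) = 1 := by
    intro c hc
    rw [IsScalarTower.algebraMap_apply ℤ_[2] ℚ_[2] (AlgebraicClosure ℚ_[2]), ← NNReal.coe_inj,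
      padicSpectralValuation_algebraMap hw, NNReal.coe_one]
    exact PadicInt.isUnit_iff.mp hc
  have h4R : (w (4 : (AlgebraicClosure ℚ_[2])) : ℝ) = 4⁻¹ := by
    rw [show (4 : (AlgebraicClosure ℚ_[2])) = algebraMap ℚ_[2] (AlgebraicClosure ℚ_[2]) 4 by rw [map_ofNat], padicSpectralValuation_algebraMap hw, padicNorm_four]
  have h4lt : w (4 : (AlgebraicClosure ℚ_[2])) < 1 := by
    rw [← NNReal.coe_lt_coe, h4R, NNReal.coe_one]; norm_num
  have hR4 : ∀ c : ℤ_[2], w (algebraMap ℤ_[2] (AlgebraicClosure ℚ_[2]) (4 * c)) ≤ w (4 : (AlgebraicClosure ℚ_[2])) := by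
    intro c
    rw [map_mul, map_ofNat (algebraMap ℤ_[2] (AlgebraicClosure ℚ_[2])) 4, Valuation.map_mul]
    exact mul_le_of_le_one_right' (hR c)
  -- the polynomial `Ψ₂Sq` of `M ⊗ ℚ̄₂`
  set f : (AlgebraicClosure ℚ_[2])[X] := (M.baseChange (AlgebraicClosure ℚ_[2])).Ψ₂Sq with hf
  have hfmap : f = M.Ψ₂Sq.map (algebraMap ℤ_[2] (AlgebraicClosure ℚ_[2])) := by rw [hf]; exact map_Ψ₂Sq M (algebraMap ℤ_[2] (AlgebraicClosure ℚ_[2]))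
  have hroot : f.eval x = 0 := by
    rw [hf, ← ΨSq_two]
    exact ((M.baseChange (AlgebraicClosure ℚ_[2])).zsmul_some_eq_zero_iff_eval_ΨSq h 2).mp hP
  have hc0 : f.coeff 0 = algebraMap ℤ_[2] (AlgebraicClosure ℚ_[2]) M.b₆ := by
    rw [hfmap, coeff_map]; congr 1; simp [Ψ₂Sq, coeff_C, coeff_X_pow]
  have hc1 : f.coeff 1 = algebraMap ℤ_[2] (AlgebraicClosure ℚ_[2]) (2 * M.b₄) := by
    rw [hfmap, coeff_map]; congr 1; simp [Ψ₂Sq, coeff_X_pow]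
  have hc2 : f.coeff 2 = algebraMap ℤ_[2] (AlgebraicClosure ℚ_[2]) M.b₂ := by
    rw [hfmap, coeff_map]; congr 1; simp [Ψ₂Sq, coeff_X_pow]
  have hc3 : f.coeff 3 = 4 := by rw [hf]; exact coeff_Ψ₂Sq _
  -- hypotheses of the domination lemma
  have hn : f.natDegree ≤ 3 := natDegree_Ψ₂Sq_le _
  have hw0 : w (f.coeff 0) = 1 := by rw [hc0]; exact hRu _ (isUnit_b₆_of_a₁_mem M h₁)
  have hwtop : w (f.coeff 3) < 1 := by rw [hc3]; exact h4lt
  have hmid : ∀ i, 0 < i → i < 3 → w (f.coeff i) ≤ w (f.coeff 3) := by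
    intro i hi0 hi3
    rw [hc3]
    interval_cases i
    · obtain ⟨c, hc⟩ := exists_two_mul_b₄_eq_four_mul M h₁
      rw [hc1, hc]; exact hR4 c
    · obtain ⟨c, hc⟩ := exists_b₂_eq_four_mul M h₁
      rw [hc2, hc]; exact hR4 c
  have key := one_lt_valuation_and_mul_pow_eq_one_of_eval_eq_zero hn hw0 hwtop hmid hroot
  rw [hc3] at key
  exact key

end Valuation

/-! ## §3 The degree of the `2`-torsion and the torsion-freeness over fields of degree prime to `3` -/

section Degree

variable (M : WeierstrassCurve ℤ_[2]) [hEt : (M.map PadicInt.toZMod).IsElliptic]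

/-- **`3 ∣ deg_{ℚ₂} x(P)` for every affine `2`-torsion point `P = (x, y)` of `M ⊗ ℚ̄₂`** (`M/ℤ₂` good supersingular:
elliptic reduction, `2 ∣ a₁`): `|x|³ = 4` and `|x|^d = |a₀| ∈ 2^ℤ` for the minimal polynomial `X^d + … + a₀` of `x`, so
`2^{2d} = 2^{−3v(a₀)}` and `3 ∣ 2d`. The `p = 2` twin of `le_natDegree_minpoly_X_of_prime_smul_eq_zero`.
[cite: Kobayashi2003, Prop. 8.7 (p. 16)] [cite: SerreInventiones1972, §1.11 Prop. 12] -/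
theorem three_dvd_natDegree_minpoly_X_of_two_smul_eq_zero (h₁ : M.a₁ ∈ IsLocalRing.maximalIdeal ℤ_[2])
    {V : WeierstrassCurve (AlgebraicClosure ℚ_[2])} (hV : M.baseChange (AlgebraicClosure ℚ_[2]) = V)
    {x y : AlgebraicClosure ℚ_[2]} {h : V.toAffine.Nonsingular x y}
    (hP : 2 • (WeierstrassCurve.Affine.Point.some x y h : V.toAffine.Point) = 0) :
    3 ∣ (minpoly ℚ_[2] x).natDegree := by
  subst hV
  obtain ⟨w, hw⟩ := exists_padicSpectralValuation 2
  have hP' : (2 : ℤ) • (WeierstrassCurve.Affine.Point.some x y h :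
      (M.baseChange (AlgebraicClosure ℚ_[2])).toAffine.Point) = 0 := by
    rw [show (2 : ℤ) = ((2 : ℕ) : ℤ) from rfl, natCast_zsmul]; exact hP
  obtain ⟨h1, h2⟩ := one_lt_valuation_X_of_two_smul_eq_zero M hw h₁ hP'
  have h4R : (w (4 : AlgebraicClosure ℚ_[2]) : ℝ) = 4⁻¹ := by
    rw [show (4 : AlgebraicClosure ℚ_[2]) = algebraMap ℚ_[2] (AlgebraicClosure ℚ_[2]) 4 by rw [map_ofNat],
      padicSpectralValuation_algebraMap hw, padicNorm_four]
  -- the degree count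
  set d : ℕ := (minpoly ℚ_[2] x).natDegree with hd
  have hx0 : x ≠ 0 := by
    rintro rfl
    rw [map_zero] at h1
    exact not_lt_zero h1
  have hint : IsIntegral ℚ_[2] x := Algebra.IsIntegral.isIntegral x
  have hdpos : 0 < d := minpoly.natDegree_pos hint
  set a : ℚ_[2] := (minpoly ℚ_[2] x).coeff 0 with ha
  have ha0 : a ≠ 0 := minpoly.coeff_zero_ne_zero hint hx0
  -- `|x| ^ d = ‖a‖`
  have hwx : (w x : ℝ) = ‖a‖ ^ (1 / (d : ℝ)) := by
    rw [hw]
    exact spectralNorm.spectralNorm_eq_norm_coeff_zero_rpow ℚ_[2] (AlgebraicClosure ℚ_[2]) x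
  have hwxd : (w x : ℝ) ^ d = ‖a‖ := by
    rw [hwx, ← Real.rpow_natCast, ← Real.rpow_mul (norm_nonneg a),
      one_div_mul_cancel (Nat.cast_ne_zero.mpr hdpos.ne'), Real.rpow_one]
  -- `‖a‖ = 2 ^ (-m)`
  have hna : ‖a‖ = ((2 : ℕ) : ℝ) ^ (-a.valuation) := Padic.norm_eq_zpow_neg_valuation ha0
  -- `|x| ^ 3 = 4 = 2 ^ 2`
  have h2R : (4 : ℝ)⁻¹ * (w x : ℝ) ^ 3 = 1 := by
    have := congrArg (fun t : ℝ≥0 ↦ (t : ℝ)) h2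
    simpa only [NNReal.coe_mul, NNReal.coe_pow, h4R, NNReal.coe_one] using this
  have hx3 : (w x : ℝ) ^ 3 = ((2 : ℕ) : ℝ) ^ (2 : ℤ) := by
    have h := congrArg (fun t : ℝ ↦ (4 : ℝ) * t) h2R
    simp only [← mul_assoc, mul_inv_cancel₀ (four_ne_zero : (4 : ℝ) ≠ 0), one_mul, mul_one] at h
    rw [h]; norm_num
  -- compare `|x| ^ (3 d)` both ways
  have hp0 : (0 : ℝ) < ((2 : ℕ) : ℝ) := by norm_num
  have hp1 : ((2 : ℕ) : ℝ) ≠ 1 := by norm_num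
  have e1 : (w x : ℝ) ^ (3 * d) = ((2 : ℕ) : ℝ) ^ (2 * (d : ℤ)) := by rw [pow_mul, hx3, ← zpow_natCast, ← zpow_mul]
  have e2 : (w x : ℝ) ^ (3 * d) = ((2 : ℕ) : ℝ) ^ (-a.valuation * 3) := by
    rw [mul_comm, pow_mul, hwxd, hna, ← zpow_natCast, ← zpow_mul]; norm_num
  have e3 : 2 * (d : ℤ) = -a.valuation * 3 := zpow_right_injective₀ hp0 hp1 (e1.symm.trans e2)
  have hdvd : (3 : ℤ) ∣ 2 * (d : ℤ) := ⟨-a.valuation, by rw [e3, mul_comm]⟩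
  have hdvd' : (3 : ℤ) ∣ (d : ℤ) := Int.dvd_of_dvd_mul_right_of_gcd_one hdvd (by norm_num)
  exact Int.natCast_dvd_natCast.mp hdvd'

/-- **No `H`-fixed `x`-coordinate on `E[2] ∖ O` when `3 ∤ [Γ : H]`** (`M/ℤ₂` good supersingular): if the `x`-coordinate
of an affine point `P` of `M ⊗ ℚ̄₂` is fixed by a subgroup `H ≤ Gal(ℚ̄₂/ℚ₂)` of finite index not divisible by `3`,
then `2 • P ≠ O` — `x` lies in the fixed field `F` of `H` and `deg x ∣ [F : ℚ₂] ∣ [Γ : H]`.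
[cite: Kobayashi2003, Prop. 8.7 (p. 16)] [cite: SerreInventiones1972, §1.11 Prop. 12] -/
theorem two_smul_some_ne_zero_of_forall_apply_eq (h₁ : M.a₁ ∈ IsLocalRing.maximalIdeal ℤ_[2])
    {V : WeierstrassCurve (AlgebraicClosure ℚ_[2])} (hV : M.baseChange (AlgebraicClosure ℚ_[2]) = V)
    (H : Subgroup (AlgebraicClosure ℚ_[2] ≃ₐ[ℚ_[2]] AlgebraicClosure ℚ_[2]))
    (hH0 : H.index ≠ 0) (hH : ¬ 3 ∣ H.index)
    {x y : AlgebraicClosure ℚ_[2]} {h : V.toAffine.Nonsingular x y} (hfix : ∀ σ ∈ H, σ x = x) :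
    2 • (WeierstrassCurve.Affine.Point.some x y h : V.toAffine.Point) ≠ 0 := by
  intro hP
  -- `x` lies in the fixed field `F` of `H`
  set F : IntermediateField ℚ_[2] (AlgebraicClosure ℚ_[2]) := IntermediateField.fixedField H with hF
  have hx : x ∈ F := by
    rw [hF, IntermediateField.mem_fixedField_iff]
    exact fun σ hσ ↦ hfix σ hσ
  have hle : H ≤ F.fixingSubgroup := (IntermediateField.le_iff_le H F).mp le_rfl
  have hdvd : F.fixingSubgroup.index ∣ H.index := Subgroup.index_dvd_of_le hle
  have hfin : Module.finrank ℚ_[2] F = F.fixingSubgroup.index :=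
    IntermediateField.finrank_eq_fixingSubgroup_index F
  have hFidx0 : F.fixingSubgroup.index ≠ 0 := fun h0 ↦ hH0 (Nat.eq_zero_of_zero_dvd (h0 ▸ hdvd))
  have hFpos : 0 < Module.finrank ℚ_[2] F := by rw [hfin]; exact Nat.pos_of_ne_zero hFidx0
  haveI : FiniteDimensional ℚ_[2] F := Module.finite_of_finrank_pos hFpos
  -- the degree of `x` divides `[F : ℚ₂]`
  have hdegdvd : (minpoly ℚ_[2] x).natDegree ∣ Module.finrank ℚ_[2] F := by
    rw [← IntermediateField.adjoin.finrank (Algebra.IsIntegral.isIntegral (R := ℚ_[2]) x)]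
    exact IntermediateField.finrank_dvd_of_le_right (IntermediateField.adjoin_simple_le_iff.mpr hx)
  have h3 := three_dvd_natDegree_minpoly_X_of_two_smul_eq_zero M h₁ hV hP
  exact hH ((h3.trans hdegdvd).trans (hfin ▸ hdvd))

/-- **`E^H[2] = 0` when `3 ∤ [Γ : H]`** (`M/ℤ₂` good supersingular), Galois form on points: a point of `M ⊗ ℚ̄₂` fixed
by every element of a subgroup `H ≤ Gal(ℚ̄₂/ℚ₂)` of finite index not divisible by `3` and killed by `2` is `O`.
With `H = Gal(ℚ̄₂/ℚ₂(ζ_{2^m}))` (index `2^{m−1}`) or `H = Gal(ℚ̄₂/ℚ_{2,n})` (index `2ⁿ`): Kobayashi's Prop. 8.7 at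
`p = 2` on every layer of both `2`-adic cyclotomic towers. [cite: Kobayashi2003, Prop. 8.7 (p. 16)] -/
theorem eq_zero_of_two_smul_eq_zero_of_forall_map_eq (h₁ : M.a₁ ∈ IsLocalRing.maximalIdeal ℤ_[2])
    (H : Subgroup (AlgebraicClosure ℚ_[2] ≃ₐ[ℚ_[2]] AlgebraicClosure ℚ_[2]))
    (hH0 : H.index ≠ 0) (hH : ¬ 3 ∣ H.index)
    {P : (M.baseChange (AlgebraicClosure ℚ_[2])).toAffine.Point}
    (hfix : ∀ σ ∈ H, WeierstrassCurve.Affine.Point.map (W' := M)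
      (σ : AlgebraicClosure ℚ_[2] →ₐ[ℚ_[2]] AlgebraicClosure ℚ_[2]) P = P)
    (hP : 2 • P = 0) : P = 0 := by
  rcases P with _ | ⟨x, y, hxy⟩
  · rfl
  exfalso
  refine two_smul_some_ne_zero_of_forall_apply_eq M h₁ rfl H hH0 hH (fun σ hσ ↦ ?_) hP
  have h := hfix σ hσ
  rw [WeierstrassCurve.Affine.Point.map_some] at h
  simp only [WeierstrassCurve.Affine.Point.some.injEq] at h
  exact h.1

/-- **`E^H[2^∞] = 0` when `3 ∤ [Γ : H]`** (`M/ℤ₂` good supersingular): the `2^k`-torsion version, by induction on `k`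
(`2^{k+1} • P = 2 • (2^k • P)` and `2^k • P` is again `H`-fixed). [cite: Kobayashi2003, Prop. 8.7 (p. 16)] -/
theorem eq_zero_of_two_pow_smul_eq_zero_of_forall_map_eq (h₁ : M.a₁ ∈ IsLocalRing.maximalIdeal ℤ_[2])
    (H : Subgroup (AlgebraicClosure ℚ_[2] ≃ₐ[ℚ_[2]] AlgebraicClosure ℚ_[2]))
    (hH0 : H.index ≠ 0) (hH : ¬ 3 ∣ H.index)
    {P : (M.baseChange (AlgebraicClosure ℚ_[2])).toAffine.Point}
    (hfix : ∀ σ ∈ H, WeierstrassCurve.Affine.Point.map (W' := M)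
      (σ : AlgebraicClosure ℚ_[2] →ₐ[ℚ_[2]] AlgebraicClosure ℚ_[2]) P = P)
    {k : ℕ} (hP : 2 ^ k • P = 0) : P = 0 := by
  induction k generalizing P with
  | zero => rwa [pow_zero, one_smul] at hP
  | succ k ih =>
    have hfix' : ∀ σ ∈ H, WeierstrassCurve.Affine.Point.map (W' := M)
        (σ : AlgebraicClosure ℚ_[2] →ₐ[ℚ_[2]] AlgebraicClosure ℚ_[2]) (2 ^ k • P) = 2 ^ k • P := fun σ hσ ↦ by
      rw [map_nsmul, hfix σ hσ]
    have h2 : 2 • (2 ^ k • P) = 0 := by rw [← mul_nsmul, ← pow_succ, hP]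
    have hk : 2 ^ k • P = 0 := eq_zero_of_two_smul_eq_zero_of_forall_map_eq M h₁ H hH0 hH hfix' h2
    exact ih hfix hk

end Degree

end SignedKatoOffTwo.LocalTwo

end Summit.BirchSwinnertonDyer.BirchSwinnertonDyer.Theorems

end
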